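import Summits.QuantumFields.YangMills.Theorems.DiagonalMirrorRPRWilsonDiagonalModelFamilyFacts

/-!
# Crux `WeakCouplingHypercubicLimitRP` (stmt-QuantumFields-27398) / aside `DiagonalMirrorRPR` (stmt-QuantumFields-10604), door B,
# construction F1_diag — step A′: the PINNED model `wilsonDiagonalTransferModel` (data by explicit formulas from the eigen-package)

Helper file (`--supports stmt-QuantumFields-27398 --as helper`) of the hand `hand-10604-wilsonDiagModel-2` g2 (self-review of p829712).  WHY THIS FILE:
`wilsonDiagonalModel` (✓p829712, `…Model`) takes its slice at each `k` by `Classical.choice (nonempty_sliceFields …)` — a choice over the TYPE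
`SliceFields r sch k`, whose inhabitants are constrained only by the interface's own clauses; it therefore PROVES `Nonempty (DiagonalSliceModel r sch)`
by the Wilson construction but its data fields are not provably the Wilson spectral data (the slice type, like the interface, also has junk
inhabitants).  Letters typed on it would be about an unspecified inhabitant.  Here the choice is moved to where every inhabitant IS Wilson data:
* `slicePkgAt r sch hβ k : SlicePkg …` — a chosen EIGEN-PACKAGE (`Classical.choice nonempty_slicePkg`): THE `L²(μ̃)` operator of the reweighted lifted
  kernel `𝔟` (unique given the bond bound), AN orthonormal eigenbasis, ITS eigenvalues, an injection of the index set into `ℕ` — every inhabitant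
  of `SlicePkg` is genuine, and the letters are invariant under the residual freedom (basis, padding, bond bound: unitarily equivalent operators);
* `SlicePkg.toFields` — ALL slice fields by EXPLICIT FORMULAS from a package: `sp = posPad emb κ`, `sm = negPad emb κ`, `top` = the (unique) top
  modulus, `wp F = P.wp (famRead F k (d_k)), wm F = P.wm (…)` (Gram weights `κᵢ²⟪bᵢ, 𝒲_F bᵢ⟫`); proofs = those of `nonempty_sliceFields`;
* `pinnedSliceFields`, ★★★ **`wilsonDiagonalTransferModel r sch hβ : DiagonalSliceModel r sch`** — the model OF RECORD for the door-B letters; and the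
  unfolding lemmas `wilsonDiagonalTransferModel_sp/_sm/_wp/_wm` (at `side_k ≥ 3`), `_depth`, so that e.g. R1 `OddTwistGap (wilsonDiagonalTransferModel …)`
  is, index by index, the statement «every NEGATIVE eigenvalue `κᵢ` of `𝔄_k` has `|κᵢ| ≤ e^{-γ a_k} · top_k`».

HONEST FRAMING: construction; no letter proved; D1′, ⟨27398⟩, S6i, ⟨10604⟩ OPEN; the Yang–Mills mass gap is NOT proved here or anywhere in the tree.
No instance, no notation, `autoImplicit false`.

References: K. Osterwalder, E. Seiler, Ann. Phys. 110 (1978) §2–3; M. Reed, B. Simon I (1980) §VI.6; B. Simon, *Trace Ideals* (2005) Ch. 3.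
-/

set_option autoImplicit false

noncomputable section

open scoped BigOperators ENNReal RealInnerProductSpace
open MeasureTheory Function Filter Topology
open Literature.MathematicalPhysics.QuantumLattice Literature.MathematicalPhysics.QuantumFieldTheory
open Summit.QuantumFields.YangMills.Cruxes.DiagonalMirrorRPR.ParityBridgeColdTraces

namespace Summit.QuantumFields.YangMills.Cruxes.DiagonalMirrorRPR.SignTwistedDiagonalTrace.WilsonDiagonal

section Pinned

variable {G : Type} [Group G] [TopologicalSpace G] [IsTopologicalGroup G] [CompactSpace G] [MeasurableSpace G] [BorelSpace G]
  (r : LatticeRep G) (sch : SpeciesScheme (YMSpecies G))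

/-- **All slice fields from an eigen-package, by explicit formulas** (`sp = posPad emb κ`, `sm = negPad emb κ`, `top` = the top modulus,
`wp/wm F` = the padded Gram weights of the family observable read on `d_k + 1` layers); proofs from `SlicePkg.spectral` / `SlicePkg.family_facts`. -/
def SlicePkg.toFields {k : ℕ} (hβ : 0 ≤ sch.β k) (h3 : 3 ≤ sch.side k)
    (P : SlicePkg (sch.side k) G r.N r.ρ (sch.β k)) : SliceFields r sch k where
  sp := posPad P.emb P.κ
  sm := negPad P.emb P.κ
  top := Classical.choose (SlicePkg.spectral r sch h3 P)
  top_pos := (Classical.choose_spec (SlicePkg.spectral r sch h3 P)).1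
  sp_nonneg := (Classical.choose_spec (SlicePkg.spectral r sch h3 P)).2.1
  sm_nonneg := (Classical.choose_spec (SlicePkg.spectral r sch h3 P)).2.2.1
  sp_le := (Classical.choose_spec (SlicePkg.spectral r sch h3 P)).2.2.2.1
  sm_le := (Classical.choose_spec (SlicePkg.spectral r sch h3 P)).2.2.2.2.1
  top_attained := (Classical.choose_spec (SlicePkg.spectral r sch h3 P)).2.2.2.2.2.1
  summable_sp := (Classical.choose_spec (SlicePkg.spectral r sch h3 P)).2.2.2.2.2.2.1
  summable_sm := (Classical.choose_spec (SlicePkg.spectral r sch h3 P)).2.2.2.2.2.2.2.1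
  trace_nonneg := (Classical.choose_spec (SlicePkg.spectral r sch h3 P)).2.2.2.2.2.2.2.2.2.2.1
  trace_side_pos := (Classical.choose_spec (SlicePkg.spectral r sch h3 P)).2.2.2.2.2.2.2.2.2.2.2
  wp F := P.wp (famRead r sch F k (famDepthSeq r sch F k))
  wm F := P.wm (famRead r sch F k (famDepthSeq r sch F k))
  wp_nonneg F := (SlicePkg.family_facts r sch hβ h3 P F).1
  wm_nonneg F := (SlicePkg.family_facts r sch hβ h3 P F).2.1
  w_bdd F := (SlicePkg.family_facts r sch hβ h3 P F).2.2.1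
  pairing F := (SlicePkg.family_facts r sch hβ h3 P F).2.2.2.1
  dom F := (SlicePkg.family_facts r sch hβ h3 P F).2.2.2.2

/-- `toFields` unfolds: the positive-sector moduli are the padded positive parts of the eigenvalues. -/
theorem SlicePkg.toFields_sp {k : ℕ} (hβ : 0 ≤ sch.β k) (h3 : 3 ≤ sch.side k) (P : SlicePkg (sch.side k) G r.N r.ρ (sch.β k)) :
    (SlicePkg.toFields r sch hβ h3 P).sp = posPad P.emb P.κ := rfl

/-- `toFields` unfolds: the negative-sector moduli are the padded negative parts of the eigenvalues. -/
theorem SlicePkg.toFields_sm {k : ℕ} (hβ : 0 ≤ sch.β k) (h3 : 3 ≤ sch.side k) (P : SlicePkg (sch.side k) G r.N r.ρ (sch.β k)) :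
    (SlicePkg.toFields r sch hβ h3 P).sm = negPad P.emb P.κ := rfl

/-- `toFields` unfolds: the positive-sector Gram weights. -/
theorem SlicePkg.toFields_wp {k : ℕ} (hβ : 0 ≤ sch.β k) (h3 : 3 ≤ sch.side k) (P : SlicePkg (sch.side k) G r.N r.ρ (sch.β k))
    (F : ReflectedFamily) : (SlicePkg.toFields r sch hβ h3 P).wp F = P.wp (famRead r sch F k (famDepthSeq r sch F k)) := rfl

/-- `toFields` unfolds: the negative-sector Gram weights. -/
theorem SlicePkg.toFields_wm {k : ℕ} (hβ : 0 ≤ sch.β k) (h3 : 3 ≤ sch.side k) (P : SlicePkg (sch.side k) G r.N r.ρ (sch.β k))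
    (F : ReflectedFamily) : (SlicePkg.toFields r sch hβ h3 P).wm F = P.wm (famRead r sch F k (famDepthSeq r sch F k)) := rfl

/-- **The eigen-package at index `k`** (chosen once; every inhabitant of `SlicePkg` is genuine Wilson data: THE kernel operator of `𝔟`, AN eigenbasis,
ITS eigenvalues, a padding injection). -/
def slicePkgAt (hβ : ∀ k, 0 ≤ sch.β k) (k : ℕ) : SlicePkg (sch.side k) G r.N r.ρ (sch.β k) :=
  haveI : SecondCountableTopology G := (r.continuous.isClosedEmbedding r.injective).isEmbedding.secondCountableTopology
  Classical.choice (nonempty_slicePkg (S := sch.side k) (Nc := r.N) (ρ := r.ρ) r.continuous (hβ k) r.mem_unitary)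

/-- **The pinned slice fields**: from the eigen-package at `k` when `side_k ≥ 3`, the dummy slice at the finitely many `side_k < 3`. -/
def pinnedSliceFields (hβ : ∀ k, 0 ≤ sch.β k) (k : ℕ) : SliceFields r sch k :=
  if h : 3 ≤ sch.side k then SlicePkg.toFields r sch (hβ k) h (slicePkgAt r sch hβ k)
  else dummySliceFields r sch k (not_le.1 h)

/-- ★★★ **The Wilson diagonal transfer model (pinned; the model OF RECORD for the door-B letters)** `wilsonDiagonalTransferModel r sch hβ :
DiagonalSliceModel r sch`: at every index with `side_k ≥ 3`, `sp k / sm k` ARE the padded positive / negative parts of the eigenvalues of the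
eigen-package `slicePkgAt r sch hβ k` (the compact self-adjoint realisation of the two-step diagonal transfer matrix of Wilson's measure on the
scheme's own odd torus), `wp/wm F k` ARE its Gram weights, `depth F k = d_k + 2`. -/
def wilsonDiagonalTransferModel (hβ : ∀ k, 0 ≤ sch.β k) : DiagonalSliceModel r sch where
  sp k := (pinnedSliceFields r sch hβ k).sp
  sm k := (pinnedSliceFields r sch hβ k).sm
  top k := (pinnedSliceFields r sch hβ k).top
  top_pos k := (pinnedSliceFields r sch hβ k).top_pos
  sp_nonneg k := (pinnedSliceFields r sch hβ k).sp_nonneg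
  sm_nonneg k := (pinnedSliceFields r sch hβ k).sm_nonneg
  sp_le k := (pinnedSliceFields r sch hβ k).sp_le
  sm_le k := (pinnedSliceFields r sch hβ k).sm_le
  top_attained k := (pinnedSliceFields r sch hβ k).top_attained
  summable_sp k := (pinnedSliceFields r sch hβ k).summable_sp
  summable_sm k := (pinnedSliceFields r sch hβ k).summable_sm
  trace_nonneg k := (pinnedSliceFields r sch hβ k).trace_nonneg
  trace_side_pos k := (pinnedSliceFields r sch hβ k).trace_side_pos
  wp F k := (pinnedSliceFields r sch hβ k).wp F
  wm F k := (pinnedSliceFields r sch hβ k).wm F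
  wp_nonneg F k := (pinnedSliceFields r sch hβ k).wp_nonneg F
  wm_nonneg F k := (pinnedSliceFields r sch hβ k).wm_nonneg F
  w_bdd F k := (pinnedSliceFields r sch hβ k).w_bdd F
  depth F k := famDepthSeq r sch F k + 2
  depth_le F := by
    obtain ⟨R, hR⟩ := exists_a_mul_famDepthSeq_add_two_le r sch F
    exact ⟨R, hR⟩
  pairing_eq F := by
    filter_upwards [eventually_goodStep r sch F] with k hk
    exact ⟨by omega, (pinnedSliceFields r sch hβ k).pairing F hk.1 hk.2⟩
  weight_dom F := by
    filter_upwards [eventually_goodStep r sch F] with k hk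
    intro t B hB
    exact (pinnedSliceFields r sch hβ k).dom F hk.1 hk.2 t B hB

/-- **R1 on the pinned model unfolds to the eigenvalues**: at an index with `side_k ≥ 3`, `sm k = negPad emb κ` of the eigen-package at `k`. -/
theorem wilsonDiagonalTransferModel_sm (hβ : ∀ k, 0 ≤ sch.β k) (k : ℕ) (h3 : 3 ≤ sch.side k) :
    (wilsonDiagonalTransferModel r sch hβ).sm k = negPad (slicePkgAt r sch hβ k).emb (slicePkgAt r sch hβ k).κ := by
  show (pinnedSliceFields r sch hβ k).sm = _
  unfold pinnedSliceFields
  rw [dif_pos h3]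
  rfl

/-- At an index with `side_k ≥ 3`, `sp k = posPad emb κ` of the eigen-package at `k`. -/
theorem wilsonDiagonalTransferModel_sp (hβ : ∀ k, 0 ≤ sch.β k) (k : ℕ) (h3 : 3 ≤ sch.side k) :
    (wilsonDiagonalTransferModel r sch hβ).sp k = posPad (slicePkgAt r sch hβ k).emb (slicePkgAt r sch hβ k).κ := by
  show (pinnedSliceFields r sch hβ k).sp = _
  unfold pinnedSliceFields
  rw [dif_pos h3]
  rfl

/-- At an index with `side_k ≥ 3`, the positive-sector Gram weights of `F` are those of the eigen-package at `k`. -/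
theorem wilsonDiagonalTransferModel_wp (hβ : ∀ k, 0 ≤ sch.β k) (F : ReflectedFamily) (k : ℕ) (h3 : 3 ≤ sch.side k) :
    (wilsonDiagonalTransferModel r sch hβ).wp F k = (slicePkgAt r sch hβ k).wp (famRead r sch F k (famDepthSeq r sch F k)) := by
  show (pinnedSliceFields r sch hβ k).wp F = _
  unfold pinnedSliceFields
  rw [dif_pos h3]
  rfl

/-- At an index with `side_k ≥ 3`, the negative-sector Gram weights of `F` are those of the eigen-package at `k`. -/
theorem wilsonDiagonalTransferModel_wm (hβ : ∀ k, 0 ≤ sch.β k) (F : ReflectedFamily) (k : ℕ) (h3 : 3 ≤ sch.side k) :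
    (wilsonDiagonalTransferModel r sch hβ).wm F k = (slicePkgAt r sch hβ k).wm (famRead r sch F k (famDepthSeq r sch F k)) := by
  show (pinnedSliceFields r sch hβ k).wm F = _
  unfold pinnedSliceFields
  rw [dif_pos h3]
  rfl

/-- The pinned model's depth is `d_k + 2`. -/
theorem wilsonDiagonalTransferModel_depth (hβ : ∀ k, 0 ≤ sch.β k) (F : ReflectedFamily) (k : ℕ) :
    (wilsonDiagonalTransferModel r sch hβ).depth F k = famDepthSeq r sch F k + 2 := rfl

/-- **Door B read on the pinned model**: R1 `OddTwistGap` and R2♭ `DiagTepid` on `wilsonDiagonalTransferModel r sch hβ`, with the growth clause, give the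
line's lattice statement `OddTorusSwapPairingLiminf r sch` (`core_of_tepid`, ✓`…TepidLetters`); with R2 `DiagLukewarm` likewise (`core_of`). -/
theorem oddTorusSwapPairingLiminf_of_transferModel_tepid (hβ : ∀ k, 0 ≤ sch.β k)
    (hR1 : OddTwistGap (wilsonDiagonalTransferModel r sch hβ)) (hR2 : DiagTepid (wilsonDiagonalTransferModel r sch hβ))
    (hG : Growth r sch) : OddTorusSwapPairingLiminf r sch :=
  core_of_tepid _ hR1 hR2 hG

/-- The same with the original R2 `DiagLukewarm`. -/
theorem oddTorusSwapPairingLiminf_of_transferModel (hβ : ∀ k, 0 ≤ sch.β k)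
    (hR1 : OddTwistGap (wilsonDiagonalTransferModel r sch hβ)) (hR2 : DiagLukewarm (wilsonDiagonalTransferModel r sch hβ))
    (hG : Growth r sch) : OddTorusSwapPairingLiminf r sch :=
  core_of _ hR1 hR2 hG

/-- The letters on the pinned model give `TwistLetters r sch`. -/
theorem twistLetters_of_transferModel (hβ : ∀ k, 0 ≤ sch.β k)
    (hR1 : OddTwistGap (wilsonDiagonalTransferModel r sch hβ)) (hR2 : DiagLukewarm (wilsonDiagonalTransferModel r sch hβ)) :
    TwistLetters r sch :=
  ⟨_, hR1, hR2⟩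

end Pinned

end Summit.QuantumFields.YangMills.Cruxes.DiagonalMirrorRPR.SignTwistedDiagonalTrace.WilsonDiagonal

end
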